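import Literature.NumberTheory.Automorphic.UnitaryGroupLineUnipotentRing            -- ★ FILE A′: `N₂`, `torus_relations_two`, `ext_two`
import Literature.NumberTheory.Automorphic.KNAQuotientIntegration                    -- ★ `anMap` (the `e ∕ he` binder shape of Gelbart's `K T N` formula)
import Literature.NumberTheory.Automorphic.ReductionTheoryGLnConjugation             -- ★ `isClosed_upperUnitriangular`
import HarnessLib

/-!
# The Borel subgroup `B₂ = T₂ N₂` of `U(σ, Φ₂)(R)` (ring-generic): `T₂`, `N₂` closed and the homeomorphism `T₂ × N₂ ≃ₜ B₂`

Topic `NumberTheory/Automorphic`; namespace `Literature.NumberTheory.Automorphic.UnitaryGroup.LineRing`.  KERNEL mathematics only: theorems, no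
definition, no named fact, no instance, no notation, no `sorry`.  Cell `pub/hodgecm-mathlib`, programme P3a, road «D-N7-inert», brick «(L8b)-H» FILE A″
(F0P3b-p01 (g6) offer, LEAD F0P3a-plan (g9) T8-28 (2) ∕ T8-33): the three STRUCTURAL hypotheses of Gelbart's `K T N` integration formula (★
`KNAQuotientIntegration.exists_measure_quotient_eq_smul_map`: `hT`, `hB` closed, `e : T × N ≃ₜ B` with `he : e = anMap`) for the rank-2 quasi-split
unitary group `U(σ, Φ₂)(R)` over ANY commutative topological ring `R` (`T₁` for closedness) — the `N = 2` twin of ★ `HeisRing.borelRingHomeomorph` ∕ ★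
`isClosed_cmBorelTriple_M` (`N = 3`).  Consumer: FILE B′ `UnitaryGroupTorusOrbitalDescentNonsplitTwo` (the CM dress at `R = ∏_{w∣v} L_w`).
HC_CM is proved only modulo the printed citations (2 remaining named inputs hLiu418, h413) until rung 0 closes; this file discharges no named fact.

MATHEMATICS ([Rogawski1990, §1.10 p. 9]; [PlatonovRapinchuk1994, §3.5]).  `g ∈ U(σ, J)(R)` (any `2 × 2` form `J`) lies in the diagonal torus `T₂` iff
`g₀₁ = g₁₀ = 0` (§1; the diagonal entries of an invertible diagonal matrix are units: `g₀₀ · (g⁻¹)₀₀ = 1`), so `T₂` is closed; `N₂` is closed (★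
`isClosed_upperUnitriangular`, any rank).  For `J = Φ₂`: an upper-triangular `b ∈ B₂` has unit diagonal `(b₀₀, b₁₁)` with `σ(b₁₁) b₀₀ = σ(b₀₀) b₁₁ = 1`
(the `(1,0)` and `(0,1)` unitarity sums), hence `t(b) := diag(b₀₀, b₁₁) ∈ T₂`, `t(b)⁻¹ b ∈ N₂`, and `(t, n) ↦ t n` is a HOMEOMORPHISM `T₂ × N₂ ≃ₜ B₂`
(§2, stated as an `∃ e, ∀ p, e p = anMap …` — the exact binder of ★ `exists_measure_quotient_eq_smul_map`; the inverse `b ↦ (t(b), t(b)⁻¹ b)` is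
continuous because `b ↦ b₀₀, b₁₁, (b⁻¹)₀₀, (b⁻¹)₁₁` are).

References: [Rogawski1990] J. D. Rogawski, *Automorphic Representations of Unitary Groups in Three Variables*, Ann. of Math. Stud. 123 (1990), §1.10
p. 9 · [PlatonovRapinchuk1994] V. Platonov, A. Rapinchuk, *Algebraic Groups and Number Theory* (1994), §3.5. -/

set_option autoImplicit false

noncomputable section

open Topology
open scoped Matrix MatrixGroups

namespace Literature.NumberTheory.Automorphic.UnitaryGroup

open Literature.NumberTheory.Automorphic Literature.NumberTheory.Automorphic.UnitaryGroup

namespace LineRing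

/-! ## §1 `T₂` by entries; `T₂`, `N₂` closed -/

section Torus

variable {R : Type*} [CommRing R] (σ : R →+* R) (J : Matrix (Fin 2) (Fin 2) R)

/-- **`g ∈ T₂ ↔ g₀₁ = 0 ∧ g₁₀ = 0`** (any `2 × 2` form `J`): an invertible diagonal matrix over a commutative ring has unit diagonal entries
(`g₀₀ (g⁻¹)₀₀ = 1`, `g₁₁ (g⁻¹)₁₁ = 1`). [cite: Rogawski1990, §1.10 p. 9] -/
theorem mem_torusU_two_iff (g : ↥(unitaryGroupOfForm σ J)) :
    g ∈ torusU σ J ↔ ((g : GL (Fin 2) R) : Matrix (Fin 2) (Fin 2) R) 0 1 = 0 ∧ ((g : GL (Fin 2) R) : Matrix (Fin 2) (Fin 2) R) 1 0 = 0 := by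
  rw [mem_torusU_iff]
  constructor
  · rintro ⟨d, hd⟩
    rw [← hd, coe_glDiagonal]
    exact ⟨Matrix.diagonal_apply_ne _ (by decide), Matrix.diagonal_apply_ne _ (by decide)⟩
  · rintro ⟨h01, h10⟩
    have hmul : ((g : GL (Fin 2) R) : Matrix (Fin 2) (Fin 2) R) * (((g : GL (Fin 2) R)⁻¹ : GL (Fin 2) R) : Matrix (Fin 2) (Fin 2) R) = 1 := by
      rw [← Units.val_mul, mul_inv_cancel, Units.val_one]
    have hmul' : (((g : GL (Fin 2) R)⁻¹ : GL (Fin 2) R) : Matrix (Fin 2) (Fin 2) R) * ((g : GL (Fin 2) R) : Matrix (Fin 2) (Fin 2) R) = 1 := by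
      rw [← Units.val_mul, inv_mul_cancel, Units.val_one]
    have h00 := congrFun (congrFun hmul 0) 0
    have h11 := congrFun (congrFun hmul' 1) 1
    rw [Matrix.mul_apply, Fin.sum_univ_two, h01, zero_mul, add_zero, Matrix.one_apply_eq] at h00
    rw [Matrix.mul_apply, Fin.sum_univ_two, h01, mul_zero, zero_add, Matrix.one_apply_eq] at h11
    refine ⟨fun k => if k = 0 then ⟨((g : GL (Fin 2) R) : Matrix (Fin 2) (Fin 2) R) 0 0,
        (((g : GL (Fin 2) R)⁻¹ : GL (Fin 2) R) : Matrix (Fin 2) (Fin 2) R) 0 0, h00, by rw [mul_comm]; exact h00⟩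
      else ⟨((g : GL (Fin 2) R) : Matrix (Fin 2) (Fin 2) R) 1 1,
        (((g : GL (Fin 2) R)⁻¹ : GL (Fin 2) R) : Matrix (Fin 2) (Fin 2) R) 1 1, by rw [mul_comm]; exact h11, h11⟩, ?_⟩
    refine Matrix.GeneralLinearGroup.ext fun i j => ?_
    rw [coe_glDiagonal]
    fin_cases i <;> fin_cases j
    · simp
    · simpa using h01.symm
    · simpa using h10.symm
    · simp

/-- **`T₂` is closed** in `U(σ, J)(R)` for a `T₁` topological ring `R` (§1: cut out by `g₀₁ = g₁₀ = 0`). [cite: PlatonovRapinchuk1994, §3.5] -/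
theorem isClosed_torusU_two [TopologicalSpace R] [T1Space R] : IsClosed (torusU σ J : Set ↥(unitaryGroupOfForm σ J)) := by
  have hcont : ∀ i j : Fin 2, Continuous fun g : ↥(unitaryGroupOfForm σ J) => ((g : GL (Fin 2) R) : Matrix (Fin 2) (Fin 2) R) i j :=
    fun i j => (Units.continuous_val.comp continuous_subtype_val).matrix_elem i j
  have hset : (torusU σ J : Set ↥(unitaryGroupOfForm σ J)) =
      {g : ↥(unitaryGroupOfForm σ J) | ((g : GL (Fin 2) R) : Matrix (Fin 2) (Fin 2) R) 0 1 = 0} ∩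
        {g : ↥(unitaryGroupOfForm σ J) | ((g : GL (Fin 2) R) : Matrix (Fin 2) (Fin 2) R) 1 0 = 0} := by
    ext g; exact mem_torusU_two_iff σ J g
  rw [hset]
  exact (isClosed_singleton.preimage (hcont 0 1)).inter (isClosed_singleton.preimage (hcont 1 0))

/-- **`N` is closed** in `U(σ, J)(R)` (any rank; ★ `isClosed_upperUnitriangular`). [cite: PlatonovRapinchuk1994, §3.5] -/
theorem isClosed_unipotentU {N : ℕ} (J' : Matrix (Fin N) (Fin N) R) [TopologicalSpace R] [T1Space R] :
    IsClosed (unipotentU σ J' : Set ↥(unitaryGroupOfForm σ J')) :=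
  (isClosed_upperUnitriangular (n := N) (R := R)).preimage continuous_subtype_val

end Torus

/-! ## §2 The homeomorphism `T₂ × N₂ ≃ₜ B₂` for `J = Φ₂` -/

section Borel

variable {R : Type*} [CommRing R] (σ : R →+* R) {J : Matrix (Fin 2) (Fin 2) R} (hJ : J = (StdForm.antidiagonal 2).over R)

/-- Shape of `b ∈ B₂`: `b₁₀ = 0` and `(b⁻¹)₁₀ = 0`. [cite: Rogawski1990, §1.10 p. 9] -/
theorem bmat_shape_two (b : ↥(borelU σ J)) :
    (((b : ↥(unitaryGroupOfForm σ J)) : GL (Fin 2) R) : Matrix (Fin 2) (Fin 2) R) 1 0 = 0 ∧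
      ((((b : ↥(unitaryGroupOfForm σ J)) : GL (Fin 2) R)⁻¹ : GL (Fin 2) R) : Matrix (Fin 2) (Fin 2) R) 1 0 = 0 := by
  have h1 := (mem_borelU_iff (b : ↥(unitaryGroupOfForm σ J))).1 b.2
  have h2 := (mem_borelU_iff ((b⁻¹ : ↥(borelU σ J)) : ↥(unitaryGroupOfForm σ J))).1 (b⁻¹).2
  exact ⟨h1 (show (id 0 : Fin 2) < id 1 by decide), h2 (show (id 0 : Fin 2) < id 1 by decide)⟩

/-- The diagonal entries of `b ∈ B₂` are units: `b₀₀ (b⁻¹)₀₀ = 1`, `b₁₁ (b⁻¹)₁₁ = 1`. [cite: Rogawski1990, §1.10 p. 9] -/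
theorem bmat_diag_mul_inv_two (b : ↥(borelU σ J)) :
    (((b : ↥(unitaryGroupOfForm σ J)) : GL (Fin 2) R) : Matrix (Fin 2) (Fin 2) R) 0 0 *
        ((((b : ↥(unitaryGroupOfForm σ J)) : GL (Fin 2) R)⁻¹ : GL (Fin 2) R) : Matrix (Fin 2) (Fin 2) R) 0 0 = 1 ∧
      (((b : ↥(unitaryGroupOfForm σ J)) : GL (Fin 2) R) : Matrix (Fin 2) (Fin 2) R) 1 1 *
        ((((b : ↥(unitaryGroupOfForm σ J)) : GL (Fin 2) R)⁻¹ : GL (Fin 2) R) : Matrix (Fin 2) (Fin 2) R) 1 1 = 1 := by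
  obtain ⟨h10, hi10⟩ := bmat_shape_two σ b
  have hmul : (((b : ↥(unitaryGroupOfForm σ J)) : GL (Fin 2) R) : Matrix (Fin 2) (Fin 2) R) *
      ((((b : ↥(unitaryGroupOfForm σ J)) : GL (Fin 2) R)⁻¹ : GL (Fin 2) R) : Matrix (Fin 2) (Fin 2) R) = 1 := by
    rw [← Units.val_mul, mul_inv_cancel, Units.val_one]
  have h00 := congrFun (congrFun hmul 0) 0
  have h11 := congrFun (congrFun hmul 1) 1
  rw [Matrix.mul_apply, Fin.sum_univ_two, hi10, mul_zero, add_zero, Matrix.one_apply_eq] at h00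
  rw [Matrix.mul_apply, Fin.sum_univ_two, h10, zero_mul, zero_add, Matrix.one_apply_eq] at h11
  exact ⟨h00, h11⟩

include hJ in
/-- The torus relations of the diagonal of `b ∈ B₂`: `σ(b₁₁) b₀₀ = 1`, `σ(b₀₀) b₁₁ = 1` (the `(1,0)`, `(0,1)` unitarity sums).
[cite: Rogawski1990, §1.10 p. 9] -/
theorem bmat_torus_relations_two (b : ↥(borelU σ J)) :
    σ ((((b : ↥(unitaryGroupOfForm σ J)) : GL (Fin 2) R) : Matrix (Fin 2) (Fin 2) R) 1 1) *
        (((b : ↥(unitaryGroupOfForm σ J)) : GL (Fin 2) R) : Matrix (Fin 2) (Fin 2) R) 0 0 = 1 ∧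
      σ ((((b : ↥(unitaryGroupOfForm σ J)) : GL (Fin 2) R) : Matrix (Fin 2) (Fin 2) R) 0 0) *
        (((b : ↥(unitaryGroupOfForm σ J)) : GL (Fin 2) R) : Matrix (Fin 2) (Fin 2) R) 1 1 = 1 := by
  have hu : ((b : ↥(unitaryGroupOfForm σ J)) : GL (Fin 2) R) ∈ unitaryGroupOfForm σ ((StdForm.antidiagonal 2).over R) := by
    rw [← hJ]; exact (b : ↥(unitaryGroupOfForm σ J)).2
  have key := (mem_unitaryGroupOfForm_antidiagonal_iff_sum' σ 2 _).1 hu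
  obtain ⟨h10, -⟩ := bmat_shape_two σ b
  have r0 : (0 : Fin 2).rev = 1 := rfl; have r1 : (1 : Fin 2).rev = 0 := rfl
  have k10 := key 1 0
  have k01 := key 0 1
  simp only [Fin.sum_univ_two, r0, r1, if_true] at k10 k01
  rw [h10, mul_zero, zero_add] at k10
  rw [h10, map_zero, zero_mul, add_zero] at k01
  exact ⟨k10, k01⟩

include hJ in
/-- **THE BOREL HOMEOMORPHISM `T₂ × N₂ ≃ₜ B₂`, `(t, n) ↦ t n`** (existence, with the ★ `anMap` binder shape of ★ `exists_measure_quotient_eq_smul_map`):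
the inverse is `b ↦ (diag(b₀₀, b₁₁), diag(b₀₀, b₁₁)⁻¹ b)`, continuous by continuity of the entries of `b` and `b⁻¹`. [cite: Rogawski1990, §1.10 p. 9]
[cite: PlatonovRapinchuk1994, §3.5] -/
theorem exists_borelHomeomorph_two [TopologicalSpace R] [IsTopologicalRing R] :
    ∃ e : ↥(torusU σ J) × ↥(unipotentU σ J) ≃ₜ ↥(borelU σ J),
      ∀ p, e p = anMap (torusU σ J) (unipotentU σ J) (borelU σ J) (torusU_le_borelU _ _) (unipotentU_le_borelU _ _) p := by
  -- the diagonal units of `b ∈ B₂`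
  have hd : ∀ b : ↥(borelU σ J), ∃ d : Fin 2 → Rˣ,
      (d 0 : R) = (((b : ↥(unitaryGroupOfForm σ J)) : GL (Fin 2) R) : Matrix (Fin 2) (Fin 2) R) 0 0 ∧
      (d 1 : R) = (((b : ↥(unitaryGroupOfForm σ J)) : GL (Fin 2) R) : Matrix (Fin 2) (Fin 2) R) 1 1 ∧
      (((d 0)⁻¹ : Rˣ) : R) = ((((b : ↥(unitaryGroupOfForm σ J)) : GL (Fin 2) R)⁻¹ : GL (Fin 2) R) : Matrix (Fin 2) (Fin 2) R) 0 0 ∧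
      (((d 1)⁻¹ : Rˣ) : R) = ((((b : ↥(unitaryGroupOfForm σ J)) : GL (Fin 2) R)⁻¹ : GL (Fin 2) R) : Matrix (Fin 2) (Fin 2) R) 1 1 := by
    intro b
    obtain ⟨h00, h11⟩ := bmat_diag_mul_inv_two σ b
    exact ⟨fun k => if k = 0 then ⟨_, _, h00, by rw [mul_comm]; exact h00⟩ else ⟨_, _, h11, by rw [mul_comm]; exact h11⟩,
      by simp, by simp, by simp, by simp⟩
  choose d hd0 hd1 hdi0 hdi1 using hd
  -- `diag(d b) ∈ T₂`
  have hmemU : ∀ b : ↥(borelU σ J), glDiagonal 2 R (d b) ∈ unitaryGroupOfForm σ J := by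
    intro b
    rw [hJ, glDiagonal_mem_unitaryGroupOfForm_antidiagonal_iff]
    obtain ⟨k10, k01⟩ := bmat_torus_relations_two σ hJ b
    intro i
    fin_cases i
    · change σ (d b 1 : R) * (d b 0 : R) = 1
      rw [hd0, hd1]; exact k10
    · change σ (d b 0 : R) * (d b 1 : R) = 1
      rw [hd0, hd1]; exact k01
  have hmemT : ∀ b : ↥(borelU σ J), (⟨glDiagonal 2 R (d b), hmemU b⟩ : ↥(unitaryGroupOfForm σ J)) ∈ torusU σ J := fun b => ⟨d b, rfl⟩
  -- `diag(d b)⁻¹ b ∈ N₂`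
  have hmemN : ∀ b : ↥(borelU σ J), (⟨glDiagonal 2 R (d b), hmemU b⟩ : ↥(unitaryGroupOfForm σ J))⁻¹ * (b : ↥(unitaryGroupOfForm σ J)) ∈
      unipotentU σ J := by
    intro b
    obtain ⟨h10, -⟩ := bmat_shape_two σ b
    have hmat : ((((⟨glDiagonal 2 R (d b), hmemU b⟩ : ↥(unitaryGroupOfForm σ J))⁻¹ * (b : ↥(unitaryGroupOfForm σ J)) :
        ↥(unitaryGroupOfForm σ J)) : GL (Fin 2) R) : Matrix (Fin 2) (Fin 2) R) =
        Matrix.diagonal (fun k => (((d b k)⁻¹ : Rˣ) : R)) * (((b : ↥(unitaryGroupOfForm σ J)) : GL (Fin 2) R) : Matrix (Fin 2) (Fin 2) R) := by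
      rw [Subgroup.coe_mul, Subgroup.coe_inv, Units.val_mul]
      change (((glDiagonal 2 R (d b))⁻¹ : GL (Fin 2) R) : Matrix (Fin 2) (Fin 2) R) * _ = _
      rw [← map_inv, coe_glDiagonal]; rfl
    rw [mem_unipotentU_iff, hmat]
    refine ⟨(Matrix.blockTriangular_diagonal _).mul ((mem_borelU_iff (b : ↥(unitaryGroupOfForm σ J))).1 b.2), fun i => ?_⟩
    have h0 : (Matrix.diagonal (fun k => (((d b k)⁻¹ : Rˣ) : R)) * (((b : ↥(unitaryGroupOfForm σ J)) : GL (Fin 2) R) : Matrix (Fin 2) (Fin 2) R)) 0 0 = 1 := by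
      rw [Matrix.mul_apply, Fin.sum_univ_two, Matrix.diagonal_apply_eq, Matrix.diagonal_apply_ne _ (by decide), zero_mul, add_zero, hdi0, mul_comm]
      exact (bmat_diag_mul_inv_two σ b).1
    have h1 : (Matrix.diagonal (fun k => (((d b k)⁻¹ : Rˣ) : R)) * (((b : ↥(unitaryGroupOfForm σ J)) : GL (Fin 2) R) : Matrix (Fin 2) (Fin 2) R)) 1 1 = 1 := by
      rw [Matrix.mul_apply, Fin.sum_univ_two, Matrix.diagonal_apply_ne _ (by decide), zero_mul, zero_add, Matrix.diagonal_apply_eq, hdi1, mul_comm]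
      exact (bmat_diag_mul_inv_two σ b).2
    fin_cases i
    exacts [h0, h1]
  -- continuity of the two projections
  have hm : Continuous fun b : ↥(borelU σ J) => (((b : ↥(unitaryGroupOfForm σ J)) : GL (Fin 2) R) : Matrix (Fin 2) (Fin 2) R) :=
    Units.continuous_val.comp (continuous_subtype_val.comp continuous_subtype_val)
  have hmi : Continuous fun b : ↥(borelU σ J) => ((((b : ↥(unitaryGroupOfForm σ J)) : GL (Fin 2) R)⁻¹ : GL (Fin 2) R) : Matrix (Fin 2) (Fin 2) R) :=
    Units.continuous_coe_inv.comp (continuous_subtype_val.comp continuous_subtype_val)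
  have hcT : Continuous fun b : ↥(borelU σ J) => (⟨⟨glDiagonal 2 R (d b), hmemU b⟩, hmemT b⟩ : ↥(torusU σ J)) := by
    have hdc : ∀ i : Fin 2, Continuous fun b : ↥(borelU σ J) => (d b i : R) := by
      intro i; fin_cases i
      exacts [(hm.matrix_elem 0 0).congr fun b => (hd0 b).symm, (hm.matrix_elem 1 1).congr fun b => (hd1 b).symm]
    have hdic : ∀ i : Fin 2, Continuous fun b : ↥(borelU σ J) => (((d b i)⁻¹ : Rˣ) : R) := by
      intro i; fin_cases i
      exacts [(hmi.matrix_elem 0 0).congr fun b => (hdi0 b).symm, (hmi.matrix_elem 1 1).congr fun b => (hdi1 b).symm]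
    refine ((Units.continuous_iff.2 ⟨?_, ?_⟩).subtype_mk _).subtype_mk _
    · change Continuous fun b : ↥(borelU σ J) => ((glDiagonal 2 R (d b) : GL (Fin 2) R) : Matrix (Fin 2) (Fin 2) R)
      simp only [coe_glDiagonal]
      refine continuous_matrix fun i j => ?_
      by_cases hij : i = j
      · subst hij; simp only [Matrix.diagonal_apply_eq]; exact hdc i
      · simp only [Matrix.diagonal_apply_ne _ hij]; exact continuous_const
    · change Continuous fun b : ↥(borelU σ J) => (((glDiagonal 2 R (d b))⁻¹ : GL (Fin 2) R) : Matrix (Fin 2) (Fin 2) R)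
      simp only [← map_inv, coe_glDiagonal]
      refine continuous_matrix fun i j => ?_
      by_cases hij : i = j
      · subst hij; simp only [Matrix.diagonal_apply_eq]; exact hdic i
      · simp only [Matrix.diagonal_apply_ne _ hij]; exact continuous_const
  have hcN : Continuous fun b : ↥(borelU σ J) =>
      (⟨(⟨glDiagonal 2 R (d b), hmemU b⟩ : ↥(unitaryGroupOfForm σ J))⁻¹ * (b : ↥(unitaryGroupOfForm σ J)), hmemN b⟩ : ↥(unipotentU σ J)) :=
    (((continuous_subtype_val.comp hcT).inv).mul continuous_subtype_val).subtype_mk _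
  -- torus part of `t n` is `t`
  have hdiag : ∀ (t : ↥(torusU σ J)) (n : ↥(unipotentU σ J)),
      (⟨⟨glDiagonal 2 R (d (anMap (torusU σ J) (unipotentU σ J) (borelU σ J) (torusU_le_borelU _ _) (unipotentU_le_borelU _ _) (t, n))),
        hmemU _⟩, hmemT _⟩ : ↥(torusU σ J)) = t := by
    intro t n
    obtain ⟨dt, hdt⟩ := (mem_torusU_iff (t : ↥(unitaryGroupOfForm σ J))).1 t.2
    obtain ⟨n10, n00, n11⟩ := umat_shape_two σ n
    have htn : ((((anMap (torusU σ J) (unipotentU σ J) (borelU σ J) (torusU_le_borelU _ _) (unipotentU_le_borelU _ _) (t, n) :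
        ↥(borelU σ J)) : ↥(unitaryGroupOfForm σ J)) : GL (Fin 2) R) : Matrix (Fin 2) (Fin 2) R) =
        Matrix.diagonal (fun k => (dt k : R)) * (((n : ↥(unitaryGroupOfForm σ J)) : GL (Fin 2) R) : Matrix (Fin 2) (Fin 2) R) := by
      rw [coe_anMap, Subgroup.coe_mul, Units.val_mul, ← hdt, coe_glDiagonal]
    have hdd : d (anMap (torusU σ J) (unipotentU σ J) (borelU σ J) (torusU_le_borelU _ _) (unipotentU_le_borelU _ _) (t, n)) = dt := by
      funext k
      ext
      fin_cases k
      · refine (hd0 _).trans ?_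
        rw [htn, Matrix.mul_apply, Fin.sum_univ_two, Matrix.diagonal_apply_eq, Matrix.diagonal_apply_ne _ (by decide), n00, zero_mul, add_zero, mul_one]
        rfl
      · refine (hd1 _).trans ?_
        rw [htn, Matrix.mul_apply, Fin.sum_univ_two, Matrix.diagonal_apply_eq, Matrix.diagonal_apply_ne _ (by decide), n11, zero_mul, zero_add, mul_one]
        rfl
    refine Subtype.ext (Subtype.ext ?_)
    change glDiagonal 2 R (d _) = ((t : ↥(unitaryGroupOfForm σ J)) : GL (Fin 2) R)
    rw [hdd, hdt]
  refine ⟨{ toFun := anMap (torusU σ J) (unipotentU σ J) (borelU σ J) (torusU_le_borelU _ _) (unipotentU_le_borelU _ _)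
            invFun := fun b => (⟨⟨glDiagonal 2 R (d b), hmemU b⟩, hmemT b⟩,
              ⟨(⟨glDiagonal 2 R (d b), hmemU b⟩ : ↥(unitaryGroupOfForm σ J))⁻¹ * (b : ↥(unitaryGroupOfForm σ J)), hmemN b⟩)
            left_inv := fun p => ?_
            right_inv := fun b => Subtype.ext ?_
            continuous_toFun := ((continuous_subtype_val.comp continuous_fst).mul (continuous_subtype_val.comp continuous_snd)).subtype_mk _
            continuous_invFun := hcT.prodMk hcN }, fun p => rfl⟩
  · obtain ⟨t, n⟩ := p
    have ht := hdiag t n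
    refine Prod.ext ht (Subtype.ext ?_)
    have ht' := congrArg (fun x : ↥(torusU σ J) => (x : ↥(unitaryGroupOfForm σ J))) ht
    simp only at ht'
    change (⟨glDiagonal 2 R (d _), hmemU _⟩ : ↥(unitaryGroupOfForm σ J))⁻¹ * ((t : ↥(unitaryGroupOfForm σ J)) * n) = (n : ↥(unitaryGroupOfForm σ J))
    rw [ht', inv_mul_cancel_left]
  · change (⟨glDiagonal 2 R (d b), hmemU b⟩ : ↥(unitaryGroupOfForm σ J)) *
        ((⟨glDiagonal 2 R (d b), hmemU b⟩ : ↥(unitaryGroupOfForm σ J))⁻¹ * (b : ↥(unitaryGroupOfForm σ J))) = b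
    rw [mul_inv_cancel_left]

end Borel

end LineRing

end Literature.NumberTheory.Automorphic.UnitaryGroup

end
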